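import Mathlib
import HarnessLib
import HarnessLib.Audit
import Summits.FinalStateConjecture.Statement
import HarnessLib.Audit.Status.Attr

/-!
Route: SettleThenCensor

# Route SettleThenCensor — settling is the one generic clause; censorship follows pointwise from the
exhaustive decomposition

X = GS ∧ SCC ("it suffices to show"). GS (GENERIC SETTLING): in the admissible class, the property
"every MGHD carries an
exhaustive, future-oriented sub-extremal N-Kerr final-state decomposition of its self-determined
exterior O, every future-complete
normalised null ray from the data staying in closure O" is TAME-Christodoulou-generic (codimension ≥
1; re-type T2, p126844:
`IsTameChristodoulouGeneric` — the escaping curve lives on ONE fixed asymptotically flat end, is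
wDist-continuous and immersed at 0).
SCC (SETTLING CERTIFIES CENSORSHIP, pointwise — no genericity): for EVERY admissible datum and every
MGHD, an exhaustive future-oriented N-Kerr
decomposition with the rays clause (sub-extremality not used) forces complete future null infinity
in the sojourn form. With the Choquet-Bruhat–Geroch
item (an MGHD exists for every admissible datum; the summit's shared stmt-9937, crux rank 9 so that
`closes` is crux-only) the summit
follows by MONOTONICITY of `IsTameChristodoulouGeneric` in the property — the only algebraic rule
the typed (curve-)genericity obeys (it is not closed under ∧, card
genericity-is-not-closed-under-and),
which is why exactly ONE clause may carry the genericity and every other clause must be a pointwise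
implication. Cards realised:
settling-certifies-censorship (spine, = SCC), genericity-is-not-closed-under-and (the assembly
rule); the capture cards
dissipation-budget-quiet-window-capture / handoff-formation-close-limit-kerr-basin are the foreseen
split of GS (Two-layer plan).
Lean: `(∀ (X : Type) [TopologicalSpace X] [ChartedSpace Literature.Geometry.Lorentzian.E3 X]
[IsManifold (modelWithCornersSelf ℝ (EuclideanSpace ℝ (Fin 3))) ((⊤ : ℕ∞) : WithTop ℕ∞) X] [T2Space
X] [SecondCountableTopology X] [ConnectedSpace X],
Literature.Geometry.Lorentzian.InitialDataSet.IsTameChristodoulouGeneric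
(Literature.Geometry.Lorentzian.admissibleVacuumData X) (fun D ↦ ∀ 𝒟 :
Literature.Geometry.Lorentzian.VacuumCauchyDevelopment D, 𝒟.IsMaximal → ∃ (O : Set 𝒟.carrier) (d :
Literature.Geometry.Lorentzian.FinalStateDecomposition 𝒟.toSpacetime O 2), (∀ i,
Literature.Geometry.Lorentzian.Kerr.IsSubextremal (d.mass i) (d.spin i)) ∧ O =
Summit.FinalStateConjecture.exteriorOf 𝒟.toCauchyDevelopment d.charted ∧
Summit.FinalStateConjecture.RaysStayInClosure 𝒟.toCauchyDevelopment O ∧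
Summit.FinalStateConjecture.HasExhaustiveCharts d ∧ Summit.FinalStateConjecture.IsFutureOriented d)
1) ∧ (∀ (X : Type) [TopologicalSpace X] [ChartedSpace Literature.Geometry.Lorentzian.E3 X]
[IsManifold (modelWithCornersSelf ℝ (EuclideanSpace ℝ (Fin 3))) ((⊤ : ℕ∞) : WithTop ℕ∞) X] [T2Space
X] [SecondCountableTopology X] [ConnectedSpace X] (D : Literature.Geometry.Lorentzian.InitialDataSet
(modelWithCornersSelf ℝ (EuclideanSpace ℝ (Fin 3))) X), D ∈
Literature.Geometry.Lorentzian.admissibleVacuumData X → ∀ 𝒟 :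
Literature.Geometry.Lorentzian.VacuumCauchyDevelopment D, 𝒟.IsMaximal → (∃ (O : Set 𝒟.carrier) (d :
Literature.Geometry.Lorentzian.FinalStateDecomposition 𝒟.toSpacetime O 2), O =
Summit.FinalStateConjecture.exteriorOf 𝒟.toCauchyDevelopment d.charted ∧
Summit.FinalStateConjecture.RaysStayInClosure 𝒟.toCauchyDevelopment O ∧
Summit.FinalStateConjecture.HasExhaustiveCharts d ∧ Summit.FinalStateConjecture.IsFutureOriented d)
→ Summit.FinalStateConjecture.HasCompleteNullInfinity 𝒟.toCauchyDevelopment)`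

## Assembly
Pure logic (sorry-free in Sketch.lean, theorem `closes`, axioms propext/choice/Quot.sound): fix X
and an exceptional datum d of the
summit property P; by MGHDExistence and SettlingCertifiesCensorship, "settles" ⇒ P pointwise on the
admissible class, so d is exceptional
for settling; GenericSettling gives one end e and the tame, immersed, injective admissible curve F
through d whose other members settle, hence
satisfy P — the same pair (e, F) witnesses tame codimension ≥ 1 for P. This is monotonicity of
`IsTameChristodoulouGeneric` in the
property (rev 4–6, 2026-08-16: items re-typed after the statement re-type T2; `closes` re-derived,
crux-only).

Rationale: WHY THIS LINE. The typed quantifier `IsTameChristodoulouGeneric 𝓓 P 1` (TameGenericity.lean; re-type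
T2 of 2026-08-16, p126844 — exactly like its topology-free
predecessor `IsChristodoulouGeneric`) is monotone in P but not closed under conjunction, so the
conjuncts of the conclusion (MGHD exists ∧ complete 𝓘⁺ ∧ settles) cannot be proved generic
separately and recombined; the only sound
thin shape is ONE generic clause plus pointwise upgrades, and the choice here is to let SETTLING
carry the genericity (it is the clause
whose exceptional set genuinely has codimension one: extremal thresholds arXiv:2402.10190,
KehleUnger2025; naked-singularity thresholds
Christodoulou1999, RodnianskiShlapentokhRothman2023) and to make censorship a pointwise COROLLARY of
the exhaustive decomposition
(Lorentzian comparison geometry: complete C²-flat slabs marching at unit lapse +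
`HasExhaustiveCharts` "for every chart time" leave no
room for a Cauchy horizon reaching infinity; far rays are controlled by the Klainerman–Nicolò
exterior, doi:10.1007/978-1-4612-2084-8,
arXiv:2211.15230, before they enter the certified late region; arXiv:0811.0354 §2.6.2 is the
perturbative shadow). Imported: the
dynamical-systems split "one absorbing property + pointwise upgrades" and, for the foreseen
decomposition of GS, "capture into a basin +
asymptotic stability of the attractor family" (Klainerman2025 §1.1.1, KlainermanSzeftel2023,
GiorgiKlainermanSzeftel2022,
ShlapentokhrothmanCosta2023). No prior route exists on this summit (negatives index empty); the line
differs from the printed programme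
(DafermosLuk2017 Conj. 1: censorship and asymptotics as parallel clauses (a)–(c)) by removing (a) as
an independent obligation.

RANKED CRUXES. #2 GenericSettling (crux; stmt-17274, restated rev 4) — for every connected one-ended
3-manifold X, the property
"every maximal vacuum Cauchy development of D admits a region O and a C² final-state decomposition d
with all (Mᵢ, aᵢ) sub-extremal,
O = J⁺(ιX) ∩ I⁻(d.charted), RaysStayInClosure O, HasExhaustiveCharts d (honest growing radii) and
IsFutureOriented d" is
TAME-Christodoulou-generic with codimension ≥ 1 in admissibleVacuumData X (the re-typed FSC with the
censorship and MGHD-existence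
conjuncts removed). [difficulty: open-problem] (why it might fail: FSC minus censorship under the
tame re-type: large-data capture,
N ≥ 2 dynamics, sub-extremal multi-Kerr asymptotic stability and TAME curve-escapability of the
codim-1 extremal / naked-singularity
thresholds (arXiv:2402.10190) are unproved; burial shortcuts are now excluded, so no cheap proof
either.) [DafermosLuk2017, Klainerman2025,
KlainermanSzeftel2023, GiorgiKlainermanSzeftel2022, ShlapentokhrothmanCosta2023, KehleUnger2025,
arXiv:2402.10190, Christodoulou1999]
#3 SettlingCertifiesCensorship (crux; stmt-17275, restated rev 4) — for every admissible datum D (no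
genericity) and every MGHD: a C²
final-state decomposition d of O = J⁺(ιX) ∩ I⁻(d.charted) with RaysStayInClosure O,
HasExhaustiveCharts d and IsFutureOriented d
(sub-extremality NOT assumed) forces complete future null infinity in Christodoulou's sojourn form
(card settling-certifies-censorship:
coverage lemma + affine-parameter comparison along the future-oriented certified slabs, far rays
through the Klainerman–Nicolò
exterior). Weaker than the rev-3 statement (two more hypotheses), still exactly what `closes`
consumes. [difficulty: L] (why it might
fail: no rates and full chart freedom in the typed convergence: sup-slab Christoffel bounds need not
be integrable along a ray, so affine
completeness is not kinematic; the orientation / rays clauses fix direction and region but add no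
rates.) [arXiv:0811.0354,
Christodoulou1999, arXiv:gr-qc/0403032, doi:10.1007/978-1-4612-2084-8, arXiv:2211.15230,
DafermosLuk2017]
#9 MGHDExistence (crux, rank 9; the summit's shared item stmt-9937 since rev 5, re-badged crux rev 6
so that `closes` is crux-only) —
Choquet-Bruhat–Geroch Thm 3 with Sbierski's dezornification over the repaired structure: every
admissible datum has a maximal vacuum Cauchy
development. Known in print, an UNPROVED tree fact (`choquetBruhat_geroch_exists_mghd_cauchy`;
closed by
`exact h.forall_mem_admissibleVacuumData` once the fact is held); residual risk is the typing of
`IsMaximal`. [difficulty: XL]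
[ChoquetBruhatGeroch1969CMP, Sbierski2016AHP, Ringstrom2009]

TWO-LAYER PLAN. GS ⇐ QuasiCapture → AsymptoticStability → GS (k = 2, depth 1), once the definition
request `QuasiFinalStateDecomposition` (the
ε-version of `FinalStateDecomposition`: same charts and clauses, the two `Tendsto … (𝓝 0)` fields
replaced by `limsup ≤ ε`) lands:
QuasiCapture = "for every tolerance function ε(m) > 0, generically every MGHD carries, for some
margin m (masses, spins and 1/N bounded
by m, 1 − |aᵢ|/Mᵢ ≥ m), an exhaustive ε(m)-quasi-decomposition" (the large-data black box: cards
dissipation-budget-quiet-window-capture,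
handoff-formation-close-limit-kerr-basin, two-boundary-squeeze-observability-lojasiewicz);
AsymptoticStability = "there is ε(m) > 0 such
that a vacuum MGHD with an exhaustive ε(m)-quasi-decomposition of margin m has a true one" (orbital
⇒ asymptotic stability: no small
geons/breathers around sub-extremal multi-Kerr; cards no-soft-geons-photon-sphere-capacity,
channels-of-energy-photon-sphere,
eternal-papapetrou-temporal-spectrum). SCC ⇐ Coverage → Comparison → SCC (the card's K1/K2) if a
prover asks for it.

KILL CRITERIA. A vacuum MGHD admitting an exhaustive C² decomposition with INCOMPLETE sojourn-𝓘⁺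
refutes SettlingCertifiesCensorship and at the same
time shows conjunct (ii) of the Statement under-determines i⁺ — close
`refuted:SettlingCertifiesCensorship` only if the witness
survives the obvious typing repair (rates / pinned flat chart); otherwise pivot: restate SCC over
the repaired decomposition. A
non-escapable exceptional datum (¬GenericSettling) refutes the summit itself (negatives index).
BURIAL (superseded 2026-08-16): under the rev-3 typing, if the burial families of card
swallow-the-datum-genericity-escape were proved, GS would have closed WITHOUT dynamics and the route
would have reported `verdict: misstated` on the
genericity quantifier (audit slack S2) rather than claiming the conjecture; that statement repair
HAS NOW HAPPENED (re-type T2, p126844: tame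
genericity on one fixed end; TameGenericity.lean P2: mass-divergent receding families are not tame;
route SwallowTheDatum retired moot):
GS was re-typed mechanically (rev 4) and SCC only gained hypotheses.

NOT DECOMPOSED YET. Everything inside GS: the capture/stability split waits for the ε-decomposition
notion (Definition requests); the regime split by N
(dispersal N = 0 via stability of Minkowski, N = 1 handoff into the Kerr basin, N ≥ 2 receding
configurations) and the extremal /
naked-singularity threshold transversality (cards third-law-transversality-injection,
wcc-tangent-profiles-smooth-spectral-instability)
are layer-2 material under QuasiCapture. Inside SCC: the coverage lemma (O exhausts the d.o.c.) and
the affine comparison lemma with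
the Klainerman–Nicolò constants are prover-level `--supports` lemmas, not items.

CHEAPEST FALSIFIER. Pathology hunt inside the typing, runnable in Lean over the prelude: in exact
Minkowski (and the pre-singular region of a
self-similar naked-singularity model), try a 'curled' flat chart whose slabs tilt to null beyond
radius 1/δ(τ) with δ(τ) → 0 — it meets
the C² slab convergence; check that `HasExhaustiveCharts` at chart times τ₁ just above τ₀ fails for
late central points (their future
misses the early curled slabs). I ran this on paper: exhaustiveness for EVERY τ₁ kills the curled
chart in the naked-singularity
geometry (central points with retarded time in (u(τ₀), u*) violate it), so SCC survives its cheapest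
attack; a refuter should redo it
in Lean for Minkowski first (NullInfinity.lean test table).

NUMBERS. Known instances of the per-datum property P: N = 0 for CK/Bieri-small data
(ChristodoulouKlainerman1993PMS41, Bieri2010JDG); N = 1
for data close to Kerr with |a| ≪ M (KlainermanSzeftel2023, GiorgiKlainermanSzeftel2022) and
codimension-3 near Schwarzschild
(DafermosHolzegelRodnianskiTaylor2021); linear theory on the full range |a| < M
(ShlapentokhrothmanCosta2023); N ≥ 2 receding: no
theorem (card receding-kerrs-exist-mixed-scattering). Exceptional strata expected of codimension
exactly 1: extremal threshold
(KehleUnger2025, arXiv:2402.10190), naked-singularity threshold (Christodoulou1999 Thm 4.1 in the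
scalar-field model). Items at open: 4.

DEFINITION REQUESTS. - `QuasiFinalStateDecomposition 𝓢 O k ε` (topic Literature/Geometry/Lorentzian,
next to KerrConvergence): the data of
  `FinalStateDecomposition` with `tendsto_truncDeviationCk` / `tendsto_deviationCk_flat` replaced by
  `∀ i R, ∀ᶠ τ in atTop, truncDeviationCk … ≤ ε` and the flat analogue; plus
`certifiedLate/certifiedSlab/HasExhaustiveCharts` verbatim
  for it — needed to file the QuasiCapture/AsymptoticStability split of GenericSettling (filed with
`--for` the GS item after open).
- cite fact wanted: Klainerman–Nicolò far-exterior regularity / completeness of the exterior part of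
𝓘⁺ for strongly asymptotically
  flat vacuum data in the Dafermos–Rodnianski class (doi:10.1007/978-1-4612-2084-8, Thm 1;
arXiv:2211.15230) over `VacuumCauchyDevelopment`,
  as the named hypothesis SCC provers will want.

Novelty: Searches (2026-08-15): `lit frontier FinalStateConjecture --since 2020` (30 rows; relevant:
arXiv:2601.01517 multi-black-hole Cauchy
data, arXiv:2601.04152 obstructions to global visibility of singularities, arXiv:2112.07183 Kerr–de
Sitter stability — none derives
censorship from asymptotics); `lit bridges FinalStateConjecture --cross any` (30 rows, surveys:
arXiv:2501.13180 SCC survey,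
arXiv:1807.08628); `lit galaxy search "final state conjecture" --star pdf` (3 hits, Penrose-type
inequalities and LIGO tests, none
structural); `lit search --hybrid` (searchd unavailable this session, rc 75 — recorded in NOTES.md);
`lit vsearch "completeness of future null
infinity follows from the exterior settling to Kerr; WCC as a consequence of the final state" -k 10
--no-graph` (10 held docs: Klainerman–Szeftel AMS-210
(2020) pp. 89–90 state WCC and Kerr stability as SEPARATE conjectures, fn. 10 gives the proper-time
reading of complete 𝓘⁺; Wald 1984 pp. 306,
345; Rendall 2008 pp. 291–296 — none derives censorship from a settling statement); the 70 open + 32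
closed cards of the sub (ledger idea list): the two structural cards realised here are graded
variant /
new-combination and no card or route assembles them.
Nearest prior art found: DafermosLuk2017 (Conjecture 1 (a)–(c): censorship and Kerr asymptotics as
parallel clauses, perturbative
regime); arXiv:0811.0354 §2.6.2 (completeness of 𝓘⁺ derived from exterior decay in the stability
setting); cards
settling-certifies-censorship (variant  [refs: 2601.01517, 2601.04152, 2112.07183, 2501.13180, 1807.08628, 0811.0354, DafermosLuk2017]

Barriers (technique_class: statement-structure, causal-comparison, dynamical-capture): - technique_class: statement-structure, causal-comparison, dynamical-capture
- Literature.Barriers.FinalStateConjecture.nakedSingularityInstability: respected — nothing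
genericity-blind is claimed about censorship for all data; SCC is an implication between the two
conclusions per datum (naked-singularity MGHDs fail its hypothesis), and GS keeps the codimension-1
quantifier where Christodoulou's 2-plane families live.
- Literature.Barriers.FinalStateConjecture.AretakisInstability: respected — sub-extremality sits
INSIDE the generic clause GS (extremal end states are allowed on the codimension-1 exceptional set,
as arXiv:2402.10190 predicts); SCC does not use sub-extremality at all.
- Literature.Barriers.FinalStateConjecture.SlowlyRotatingKerrFrontier: it does not evade it; the bet
is that the full-range linear theory (ShlapentokhrothmanCosta2023) upgrades to nonlinear multi-Kerr
asymptotic stability inside the foreseen AsymptoticStability child of GS — the frontier is exactly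
GS's why-it-might-fail.
- Literature.Barriers.FinalStateConjecture.PriceLawTail: not engaged by the typed clauses (no rates
are asserted); conceded that SCC's comparison lemma may need integrable Christoffel decay along
rays, which Price-law t⁻³ tails provide in the honest region.
- Literature.Barriers.FinalStateConjecture.KehrbergerLogarithmicAsymptotics: evaded — sojourn
completeness and C² slab convergence only; no conformal compactification, no peeling (Kehrberger's
logs are invisible to both cruxes)

History (route lifecycle, newest last):
- 2026-08-16T23:11:45Z · rev 4: restated GenericSettling (stmt-FinalStateConjecture-10007), SettlingCertifiesCensorship (stmt-FinalStateConjecture-10008) — route-repair (statement-revised p126844, re-type T2): restate GenericSettling to IsTameChristodoulouGeneric with the re-typed settling clause (+ RaysStayInClosu (planner-rrepair-FinalStateConjecture-SettleThe-3f57a8c7-0)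
- 2026-08-16T23:13:40Z · rev 5: restated MGHDExistence (stmt-FinalStateConjecture-10009) — route-repair (cont.): restate MGHDExistence VERBATIM as the summit's shared item stmt-FinalStateConjecture-9937 (binder style `∀ D ∈ …`, `𝓡 3`) so the route att (planner-rrepair-FinalStateConjecture-SettleThe-3f57a8c7-0)
- 2026-08-24T06:16:32Z · DORMANT — reconciler: no traction for 6.6 d (last activity item-evidence-added at 2026-08-17T15:45:33Z); parked, not closed — `ledger route dormant route-FinalStateConjec (operator:999:3635747)
- 2026-08-30T02:45:51Z · REACTIVATED — reconciler: reactivated — activity statement-attached at 2026-08-30T01:52:06Z after parking at 2026-08-24T06:16:32Z (operator:999:959324)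

sub-problem: FinalStateConjecture · status: open · opened planner-plan-FinalStateConjecture-0 2026-08-15T15:00:52Z · rev 8 · ledger route-FinalStateConjecture-SettleThenCensor
GENERATED by the gate from the ledger (D-0016/17). Provers cite these decls: `theorem foo : Summit.FinalStateConjecture.FinalStateConjecture.Theses.SettleThenCensor.<Decl> := …` in Summits/FinalStateConjecture/FinalStateConjecture/Theorems/<Name>.lean.
-/

namespace Summit.FinalStateConjecture.FinalStateConjecture.Theses.SettleThenCensor

open scoped BigOperators Topology Manifold Classical MeasureTheory ProbabilityTheory Matrix InnerProductSpace ComplexConjugate ContinuousMap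
open Filter Set Function TopologicalSpace MeasureTheory

attribute [summit_statement] _root_.FinalStateConjecture

-- earlier GenericSettling (stmt-FinalStateConjecture-10007, replaced 2026-08-16T23:11:45Z -> stmt-FinalStateConjecture-17274): retired by None — ∀ (X : Type) [TopologicalSpace X] [ChartedSpace Literature.Geometry.Lorentzian.E3 X] [IsManifold (modelWithCornersSelf ℝ (EuclideanSpace ℝ (Fin 3))) ((⊤ : ℕ∞) : WithTop ℕ∞) X] [T2Space X] [SecondCountableTopology X] [ConnectedSpace X], Literature.Geometry.L
/-- item stmt-FinalStateConjecture-17274 · crux · rank 2 · open · by planner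
why it might fail: FSC minus censorship under the tame re-type: large-data capture, N≥2 dynamics, sub-extremal multi-Kerr asymptotic stability and TAME curve-escapability of the codim-1 extremal/naked-singularity thresholds (arXiv:2402.10190) are unproved; burial shortcuts are now excluded, so no cheap proof either.
sources: DafermosLuk2017, KlainermanSzeftel2023, GiorgiKlainermanSzeftel2022, DafermosHolzegelRodnianskiTaylor2021, ShlapentokhrothmanCosta2023, KehleUnger2025
[crux] for every connected one-ended 3-manifold X, the property "every maximal vacuum Cauchy
development of D admits a region O and a C² final-state decomposition d with all (Mᵢ, aᵢ)
sub-extremal, O = J⁺(ιX) ∩ I⁻(d.charted), every future-complete normalised null ray from the data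
staying in closure O (RaysStayInClosure), HasExhaustiveCharts d (honest growing near-zone radii) and
IsFutureOriented d (orthochronous motions, transported Kerr time vectors eventually
future-directed)" is TAME-Christodoulou-generic with codimension ≥ 1 in admissibleVacuumData X
(IsTameChristodoulouGeneric … 1: the escaping curve lives on ONE fixed asymptotically flat end, is
wDist-continuous and immersed at 0) — the re-typed FSC (T2, p126844) with the censorship conjunct
and the MGHD-existence conjunct removed. [difficulty: open-problem] -/
@[route_item "route-FinalStateConjecture-SettleThenCensor", crux]
def GenericSettling : Prop :=
  ∀ (X : Type) [TopologicalSpace X] [ChartedSpace Literature.Geometry.Lorentzian.E3 X] [IsManifold (modelWithCornersSelf ℝ (EuclideanSpace ℝ (Fin 3))) ((⊤ : ℕ∞) : WithTop ℕ∞) X] [T2Space X] [SecondCountableTopology X] [ConnectedSpace X], Literature.Geometry.Lorentzian.InitialDataSet.IsTameChristodoulouGeneric (Literature.Geometry.Lorentzian.admissibleVacuumData X) (fun D ↦ ∀ 𝒟 : Literature.Geometry.Lorentzian.VacuumCauchyDevelopment D, 𝒟.IsMaximal → ∃ (O : Set 𝒟.carrier) (d : Literature.Geometry.Lorentzian.FinalStateDecomposition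 𝒟.toSpacetime O 2), (∀ i, Literature.Geometry.Lorentzian.Kerr.IsSubextremal (d.mass i) (d.spin i)) ∧ O = Summit.FinalStateConjecture.exteriorOf 𝒟.toCauchyDevelopment d.charted ∧ Summit.FinalStateConjecture.RaysStayInClosure 𝒟.toCauchyDevelopment O ∧ Summit.FinalStateConjecture.HasExhaustiveCharts d ∧ Summit.FinalStateConjecture.IsFutureOriented d) 1

-- earlier SettlingCertifiesCensorship (stmt-FinalStateConjecture-10008, replaced 2026-08-16T23:11:45Z -> stmt-FinalStateConjecture-17275): retired by None — ∀ (X : Type) [TopologicalSpace X] [ChartedSpace Literature.Geometry.Lorentzian.E3 X] [IsManifold (modelWithCornersSelf ℝ (EuclideanSpace ℝ (Fin 3))) ((⊤ : ℕ∞) : WithTop ℕ∞) X] [T2Space X] [SecondCountableTopology X] [ConnectedSpace X] (D : Liter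
/-- item stmt-FinalStateConjecture-17275 · crux · rank 3 · open · by planner
why it might fail: Rate-free C² chart convergence: sojourn ≥ s of far ingoing rays inside J⁺(ιB₀) (Klainerman–Nicolò covers only rays staying outside) needs an affine/chart-time comparison that Grönwall gives only if sup|∂g̃|=O(1/t); the orientation/rays clauses fix direction and region but add no rates.
sources: Christodoulou1999, DafermosRodnianski2008, arXiv:gr-qc/0403032, KlainermanNicolo2003, ChristodoulouKlainerman1993PMS41, RodnianskiShlapentokhRothman2023
[crux] for every admissible datum D (no genericity) and every maximal vacuum Cauchy development: a
C² final-state decomposition d of O = J⁺(ιX) ∩ I⁻(d.charted) with RaysStayInClosure O,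
HasExhaustiveCharts d (honest radii) and IsFutureOriented d — sub-extremality NOT assumed — forces
complete future null infinity in Christodoulou's sojourn form (card settling-certifies-censorship:
coverage lemma + affine-parameter comparison along the future-oriented certified slabs, far rays
through the Klainerman–Nicolò exterior). Weaker than the rev-3 statement (more hypotheses), still
exactly what `closes` consumes. [difficulty: L] -/
@[route_item "route-FinalStateConjecture-SettleThenCensor", crux]
def SettlingCertifiesCensorship : Prop :=
  ∀ (X : Type) [TopologicalSpace X] [ChartedSpace Literature.Geometry.Lorentzian.E3 X] [IsManifold (modelWithCornersSelf ℝ (EuclideanSpace ℝ (Fin 3))) ((⊤ : ℕ∞) : WithTop ℕ∞) X] [T2Space X] [SecondCountableTopology X] [ConnectedSpace X] (D : Literature.Geometry.Lorentzian.InitialDataSet (modelWithCornersSelf ℝ (EuclideanSpace ℝ (Fin 3))) X), D ∈ Literature.Geometry.Lorentzian.admissibleVacuumData X → ∀ 𝒟 : Literature.Geometry.Lorentzian.VacuumCauchyDevelopment D, 𝒟.IsMaximal → (∃ (O : Set 𝒟.carrier) (d : Literature.Geometry.Lorentzian.FinalStateDecomposition 𝒟.toSpacetime O 2), O = Summit.FinalStateConjecture.exteriorOf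 𝒟.toCauchyDevelopment d.charted ∧ Summit.FinalStateConjecture.RaysStayInClosure 𝒟.toCauchyDevelopment O ∧ Summit.FinalStateConjecture.HasExhaustiveCharts d ∧ Summit.FinalStateConjecture.IsFutureOriented d) → Summit.FinalStateConjecture.HasCompleteNullInfinity 𝒟.toCauchyDevelopment

-- earlier MGHDExistence (stmt-FinalStateConjecture-10009, replaced 2026-08-16T23:13:40Z -> stmt-FinalStateConjecture-9937): open — ∀ (X : Type) [TopologicalSpace X] [ChartedSpace Literature.Geometry.Lorentzian.E3 X] [IsManifold (modelWithCornersSelf ℝ (EuclideanSpace ℝ (Fin 3))) ((⊤ : ℕ∞) : WithTop ℕ∞) X] [T2Space X] [SecondCountableTopology X] [ConnectedSpace X] (D : Literature.Geometry.Lorentzian.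
/-- item stmt-FinalStateConjecture-9937 · crux · rank 9 · open · by planner
why it might fail: Known in print (CBG 1969 Thm 3 = unproved tree fact choquetBruhat_geroch_exists_mghd_cauchy, XL) but typing-exposed: IsMaximal makes EVERY VacuumCauchyDevelopment.{0} of D embed ι-compatibly into one 𝒟; a rogue typed development falsifies it (1st render over VacuumDevelopment was refuted: isEmpty).
sources: Literature.Geometry.Lorentzian.choquetBruhat_geroch_exists_mghd_cauchy, Literature.Geometry.Lorentzian.choquetBruhat_geroch_exists_mghd_cauchy.forall_mem_admissibleVacuumData, ChoquetBruhatGeroch1969CMP, Sbierski2016AHP, Ringstrom2009, Literature.Geometry.Lorentzian.VacuumDevelopment.isEmpty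
[support] every admissible datum has a maximal globally hyperbolic vacuum development, stated over
the repaired structure `VacuumCauchyDevelopment` (the corrected form of the deprecated
`choquetBruhat_geroch_exists_mghd`, recorded in `CauchyProblemExistenceDefect`);
Choquet-Bruhat–Geroch 1969 Thm. 3, Sbierski 2016 Thm. 2.6. Known theorem; large formalisation;
shared by every route of this summit. [difficulty: XL] -/
@[route_item "route-FinalStateConjecture-SettleThenCensor", crux]
def MGHDExistence : Prop :=
  ∀ (X : Type) [TopologicalSpace X] [ChartedSpace Literature.Geometry.Lorentzian.E3 X] [IsManifold (𝓡 3) ((⊤ : ℕ∞) : WithTop ℕ∞) X] [T2Space X] [SecondCountableTopology X] [ConnectedSpace X], ∀ D ∈ Literature.Geometry.Lorentzian.admissibleVacuumData X, ∃ 𝒟 : Literature.Geometry.Lorentzian.VacuumCauchyDevelopment D, 𝒟.IsMaximal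

/-- item stmt-FinalStateConjecture-10010 · assembly · rank 1 · open · by planner
sources: Christodoulou1999, DafermosLuk2017
[assembly] GenericSettling → SettlingCertifiesCensorship → MGHDExistence → FinalStateConjecture. -/
@[route_item "route-FinalStateConjecture-SettleThenCensor"]
def Assembly : Prop :=
  GenericSettling → SettlingCertifiesCensorship → MGHDExistence → FinalStateConjecture

/-! D-0027 §2.1 — DECIDING THEOREM (planner-authored via `route open/edit --closes-file`; by planner-rbadge-FinalStateConjecture-SettleThen-1eafb26c-0 2026-08-16T23:47:27Z):
its hypotheses are this route's items and its conclusion the sub-problem Statement (glue_lint), and it elaborates with this file. -/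

@[closes "route-FinalStateConjecture-SettleThenCensor"] theorem closes (hG : GenericSettling) (hC : SettlingCertifiesCensorship) (hE : MGHDExistence) :
    FinalStateConjecture := by
  intro X _ _ _ _ _ _
  -- MONOTONICITY of tame Christodoulou-genericity in the property (the one algebraic rule the
  -- typed genericity obeys): the same fixed end `e` and the same tame, immersed, injective
  -- admissible curve `F` that escape the exceptional set of `P` escape the smaller exceptional
  -- set of any pointwise consequence `Q` of `P` on the admissible class.
  have mono : ∀ {P Q : Literature.Geometry.Lorentzian.InitialDataSet (𝓡 3) X → Prop},
      (∀ D ∈ Literature.Geometry.Lorentzian.admissibleVacuumData X, P D → Q D) →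
        Literature.Geometry.Lorentzian.InitialDataSet.IsTameChristodoulouGeneric
            (Literature.Geometry.Lorentzian.admissibleVacuumData X) P 1 →
          Literature.Geometry.Lorentzian.InitialDataSet.IsTameChristodoulouGeneric
            (Literature.Geometry.Lorentzian.admissibleVacuumData X) Q 1 := by
    intro P Q hPQ hP d hd
    obtain ⟨e, F, hF, hImm, h0, hinj, hD, hEsc⟩ := hP d ⟨hd.1, fun h ↦ hd.2 (hPQ d hd.1 h)⟩
    exact ⟨e, F, hF, hImm, h0, hinj, hD, fun c hc hc' ↦
      hEsc c hc ⟨hc'.1, fun h ↦ hc'.2 (hPQ (F c) hc'.1 h)⟩⟩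
  -- POINTWISE UPGRADE on the admissible class (no genericity): GenericSettling carries the
  -- genericity; settling of every MGHD yields the full summit property because MGHDExistence
  -- supplies the maximal development and SettlingCertifiesCensorship the complete 𝓘⁺
  -- (sub-extremality of the final holes is simply forgotten in that step).
  refine mono ?_ (hG X)
  intro D hD hS
  refine ⟨hE X D hD, fun 𝒟 h𝒟 ↦ ⟨?_, hS 𝒟 h𝒟⟩⟩
  obtain ⟨O, dd, -, hO, hR, hex, hfo⟩ := hS 𝒟 h𝒟
  exact hC X D hD 𝒟 h𝒟 ⟨O, dd, hO, hR, hex, hfo⟩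

end Summit.FinalStateConjecture.FinalStateConjecture.Theses.SettleThenCensor
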